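import Summits.CriticalPhenomena.PercolationContinuityZ3.Theorems.Transplant.FKConnectivityAllQWheelAutomaton
import HarnessLib

/-!
# Connectivity correlation inequalities for `φ_{w,q}`, every `q > 0` — CLUSTER COUNTS OF APEX-OVER-CYCLE CONFIGURATIONS
# (the combinatorial half of LEMMA T: `k(ω) = 1 + #{rim arcs without an open spoke}`, computed by the rim automaton; file 2, on top of
# `…WheelAutomaton.lean`)

Support file (`--supports stmt-CriticalPhenomena-4575`), FK sub-lane `prim-bschramm-fk-3` (gen 8) of the post-continuity programme; builds on
p205010 (kernel theorem, internal audit signed; external expert review pending).  Pure finite graph theory (no measures); no named facts, no sorries;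
standard axioms.  Blueprint: bschramm/prim-bschramm-fk-3/WHEELS-HUB-NC.md §2 (LEMMA T) and §6.

SETTING.  A finite vertex type `V` with `Fintype.card V = n + 1`, a hub `x` and the rim vertices `v 0, …, v (n−1)` (pairwise distinct, `≠ x`); spoke
pairs `s(x, v j)` and rim pairs `s(v j, v ((j+1) % n))`; Boolean states `σ j` (spoke `j` open) and `τ j` (rim pair `j` open).  The open configuration is
built vertex by vertex, `FK.Wheel.conf σ τ x v n i` = the open pairs among the spokes and rim pairs of the vertices `j < i`, and the RIM AUTOMATON
`FK.Wheel.run σ τ i = (c, s)` reads the same letters: `s` = 'the current rim arc already carries an open spoke', `c` = the number of closed rim pairs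
that closed an arc WITHOUT open spoke.  These are exactly the states / `q`-exponents of the 2×2 transfer matrices `spokeM`, `edgeM` of
`…AllQWheelTransfer.lean` at parameters in `{0,1}`.
RESULTS (the invariant `FK.Wheel.conf_inv` and its consequences):
* **`FK.Wheel.clusterCount_conf_of_cut`** — if the closing rim pair `s(v (n−1), v 0)` is closed (`τ (n−1) = false`), then
  `k(conf n) = (run n).1 + 1` (one cluster for the hub with its attached arcs, one per spoke-less arc);
* **`FK.Wheel.clusterCount_conf_of_no_cut`** — if every rim pair is open, `k(conf n) = 1` if some spoke is open and `= 2` otherwise;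
* `FK.Wheel.mem_conf_iff` — `conf i` is the set of open pairs of the vertices `< i`.
With `FK.rcPartitionFunctionW_rigid_eq_pow` / `FK.eq_of_affine_of_rigid` (`…AllQRigidInterpolation.lean`) and the deterministic evaluation of the rigid
transfer words this yields LEMMA T (`Z_G = q·[Tr ∏ E(r_i)S(p_i) − (2−q)∏ r_i ∏(1−p_v)]`), hence — by `…AllQWheelTransfer.lean` — negative correlation of
any two spokes and of any two rim pairs of every apex-over-cycle weighted graph for every `0 < q ≤ 1` (THEOREMS W, W′ of the memo).  A cut can always be
rotated to the closing position by re-indexing the rim, which is why only `τ (n−1) = false` and the no-cut case are treated.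
[cite: Grimmett2006, §1.2 eq. (1.1), §1.4 eq. (1.20) (pp. 4, 15)]
-/

noncomputable section

namespace Summit.CriticalPhenomena.PercolationContinuityZ3.Theorems

namespace FK

namespace Wheel

open Literature.Probability.LatticeModels Literature.Probability.Percolation
open scoped Classical

variable {V : Type*} [Fintype V] [DecidableEq V]

variable (σ τ : ℕ → Bool) (x : V) (v : ℕ → V) (n : ℕ)

/-! ### The invariant of the vertex-by-vertex construction -/

section Inv

variable {σ τ x v n}
variable (hn : 1 ≤ n) (hinj : ∀ j k, j < n → k < n → v j = v k → j = k) (hx : ∀ j, j < n → v j ≠ x) (hcard : Fintype.card V = n + 1)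
include hn hinj hx hcard

omit hn hinj hcard in
/-- **The spoke step**: from the invariant data at vertex `i` (`i < n`), the configuration `confS i` (spoke of `i` inserted if open) satisfies
`k(confS i) + [¬s] = k(conf i) + [¬(s ∨ σ i)]` and `x ↔ v i ⟺ s ∨ σ i`, where `s` is the automaton state. [folklore] -/
theorem confS_facts (i : ℕ) (hi : i < n)
    (hb : (openGraph (↑(conf σ τ x v n i) : BondConfig V)).Reachable x (v i) ↔ (run σ τ i).2 = true) :
    clusterCount (↑(confS σ τ x v n i) : BondConfig V) (∅ : Set V) + (if (run σ τ i).2 = true then 0 else 1) =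
        clusterCount (↑(conf σ τ x v n i) : BondConfig V) (∅ : Set V) + (if ((run σ τ i).2 || σ i) = true then 0 else 1) ∧
      ((openGraph (↑(confS σ τ x v n i) : BondConfig V)).Reachable x (v i) ↔ ((run σ τ i).2 || σ i) = true) := by
  cases hs : σ i
  · rw [confS_of_closed σ τ x v n hs, Bool.or_false]
    exact ⟨rfl, hb⟩
  · rw [confS_of_open σ τ x v n hs, Bool.or_true]
    refine ⟨?_, ?_⟩
    · cases h2 : (run σ τ i).2
      · have hr : ¬ (openGraph (↑(conf σ τ x v n i) : BondConfig V)).Reachable x (v i) := fun h => by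
          have := hb.1 h; rw [h2] at this; exact Bool.false_ne_true this
        rw [ind_of_false rfl, ind_of_true rfl, add_zero]
        exact clusterCount_insert_of_not_reachable _ hr
      · have hr : (openGraph (↑(conf σ τ x v n i) : BondConfig V)).Reachable x (v i) := hb.2 h2
        rw [ind_of_true rfl, clusterCount_insert_of_reachable _ hr]
    · simp only [iff_true]
      rw [Finset.coe_insert]
      have hadj : (openGraph (insert s(x, v i) (↑(conf σ τ x v n i) : BondConfig V))).Adj x (v i) := by
        rw [openGraph_adj]
        exact ⟨Set.mem_insert _ _, (hx i hi).symm⟩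
      exact hadj.reachable

/-- **The invariant** after the vertices `< i` (`i ≤ n − 1`): (a) the cluster count is `1 + c + [¬s] + (n − 1 − i)` (hub cluster, counted spoke-less arcs,
the current arc if unattached, the untouched rim vertices); (b) the hub is joined to the current vertex `v i` iff the automaton state is 'attached';
(c) the vertices `v j`, `i < j < n`, are untouched; (d) if all rim pairs so far are open, `v 0` is joined to `v i`.
(transcription of bschramm/prim-bschramm-fk-3/WHEELS-HUB-NC.md §2, §6) -/
theorem conf_inv (i : ℕ) (hi : i + 1 ≤ n) :
    clusterCount (↑(conf σ τ x v n i) : BondConfig V) (∅ : Set V) + i =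
        n + (run σ τ i).1 + (if (run σ τ i).2 = true then 0 else 1) ∧
      ((openGraph (↑(conf σ τ x v n i) : BondConfig V)).Reachable x (v i) ↔ (run σ τ i).2 = true) ∧
      (∀ j, i < j → j < n → ∀ e ∈ conf σ τ x v n i, v j ∉ e) ∧
      ((∀ j, j < i → τ j = true) → (openGraph (↑(conf σ τ x v n i) : BondConfig V)).Reachable (v 0) (v i)) := by
  induction i with
  | zero =>
    refine ⟨?_, ?_, ?_, ?_⟩
    · show clusterCount (↑(∅ : Finset (Sym2 V)) : BondConfig V) ∅ + 0 = n + 0 + (if false = true then 0 else 1)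
      rw [clusterCount_emptyFinset, hcard, ind_of_false rfl]
    · show (openGraph (↑(∅ : Finset (Sym2 V)) : BondConfig V)).Reachable x (v 0) ↔ false = true
      simp only [Bool.false_eq_true, iff_false]
      exact not_reachable_of_fresh (ω := (∅ : Finset (Sym2 V))) (fun e he => absurd he (Finset.notMem_empty e)) (hx 0 (by omega)).symm
    · intro j _ _ e he
      exact absurd he (Finset.notMem_empty e)
    · intro _
      exact SimpleGraph.Reachable.refl _
  | succ i ih =>
    obtain ⟨ha, hb, hc, hd⟩ := ih (by omega)
    have hi' : i < n := by omega
    have hi1 : i + 1 < n := by omega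
    have hmod : (i + 1) % n = i + 1 := Nat.mod_eq_of_lt hi1
    have hvne : v (i + 1) ≠ v i := fun h => by have := hinj _ _ hi1 hi' h; omega
    have hvx : v (i + 1) ≠ x := hx _ hi1
    obtain ⟨hk, hreach⟩ := confS_facts (σ := σ) (τ := τ) hx i hi' hb
    -- freshness of the later vertices persists after the spoke
    have hfreshS : ∀ j, i < j → j < n → ∀ e ∈ confS σ τ x v n i, v j ∉ e := by
      intro j hj hjn e he
      rcases (mem_confS_iff σ τ x v n e).1 he with ⟨-, rfl⟩ | he
      · rw [Sym2.mem_iff, not_or]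
        exact ⟨hx j hjn, fun h => by have := hinj _ _ hjn hi' h; omega⟩
      · exact hc j hj hjn e he
    have hnr : ∀ y, y ≠ v (i + 1) → ¬ (openGraph (↑(confS σ τ x v n i) : BondConfig V)).Reachable y (v (i + 1)) :=
      fun y hy => not_reachable_of_fresh (hfreshS (i + 1) (Nat.lt_succ_self i) hi1) hy
    have hd' : (∀ j, j < i → τ j = true) → (openGraph (↑(confS σ τ x v n i) : BondConfig V)).Reachable (v 0) (v i) := by
      intro hall
      cases hs : σ i
      · rw [confS_of_closed σ τ x v n hs]; exact hd hall
      · rw [confS_of_open σ τ x v n hs]; exact reachable_insert_of_reachable _ _ (hd hall)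
    cases ht : τ i
    · -- closed rim pair: no insertion, the arc is closed, a fresh arc starts at `v (i+1)`
      rw [conf_succ_of_closed σ τ x v n ht, run_succ_fst_of_closed σ τ ht, run_succ_snd_of_closed σ τ ht, ind_of_false rfl]
      refine ⟨?_, ?_, ?_, ?_⟩
      · cases h2 : (run σ τ i).2 <;> cases h3 : σ i <;>
          simp only [h2, h3, Bool.or_false, Bool.or_true, if_true, if_false, Bool.false_eq_true] at hk ha ⊢ <;> omega
      · simp only [Bool.false_eq_true, iff_false]
        exact hnr x hvx.symm
      · intro j hj hjn e he
        exact hfreshS j (by omega) hjn e he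
      · intro hall
        have := hall i (Nat.lt_succ_self i)
        rw [ht] at this
        exact absurd this Bool.false_ne_true
    · -- open rim pair: `v (i+1)` joins the current arc
      rw [conf_succ_of_open σ τ x v n ht, hmod, run_succ_fst_of_open σ τ ht, run_succ_snd_of_open σ τ ht]
      have hins := clusterCount_insert_of_not_reachable (confS σ τ x v n i) (hnr (v i) hvne.symm)
      refine ⟨?_, ?_, ?_, ?_⟩
      · cases h2 : (run σ τ i).2 <;> cases h3 : σ i <;>
          simp only [h2, h3, Bool.or_false, Bool.or_true, if_true, if_false, Bool.false_eq_true] at hk ha ⊢ <;> omega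
      · rw [reachable_coe_insert_iff]
        constructor
        · rintro (h | ⟨h, -⟩ | ⟨h, -⟩)
          · exact absurd h (hnr x hvx.symm)
          · exact hreach.1 h
          · exact absurd h (hnr x hvx.symm)
        · intro h
          exact Or.inr (Or.inl ⟨hreach.2 h, SimpleGraph.Reachable.refl _⟩)
      · intro j hj hjn e he
        rw [Finset.mem_insert] at he
        rcases he with rfl | he
        · rw [Sym2.mem_iff, not_or]
          exact ⟨fun h => by have := hinj _ _ hjn hi' h; omega, fun h => by have := hinj _ _ hjn hi1 h; omega⟩
        · exact hfreshS j (by omega) hjn e he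
      · intro hall
        rw [reachable_coe_insert_iff]
        exact Or.inr (Or.inl ⟨hd' fun j hj => hall j (Nat.lt_succ_of_lt hj), SimpleGraph.Reachable.refl _⟩)

/-- **Cluster count when the closing rim pair is closed** (`τ (n−1) = false`): `k(conf n) = (run n).1 + 1` — the hub cluster plus one cluster per spoke-less
rim arc, as counted by the rim automaton. (transcription of bschramm/prim-bschramm-fk-3/WHEELS-HUB-NC.md §2) -/
theorem clusterCount_conf_of_cut (hcut : τ (n - 1) = false) :
    clusterCount (↑(conf σ τ x v n n) : BondConfig V) (∅ : Set V) = (run σ τ n).1 + 1 := by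
  have hm : n - 1 + 1 = n := by omega
  obtain ⟨ha, hb, -, -⟩ := conf_inv hn hinj hx hcard (n - 1) (by omega)
  obtain ⟨hk, -⟩ := confS_facts (σ := σ) (τ := τ) hx (n - 1) (by omega) hb
  have e1 : conf σ τ x v n n = confS σ τ x v n (n - 1) := by
    rw [← conf_succ_of_closed σ τ x v n hcut, hm]
  have e2 : (run σ τ n).1 = (run σ τ (n - 1)).1 + (if ((run σ τ (n - 1)).2 || σ (n - 1)) = true then 0 else 1) := by
    rw [← run_succ_fst_of_closed σ τ hcut, hm]
  rw [e1, e2]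
  cases h2 : (run σ τ (n - 1)).2 <;> cases h3 : σ (n - 1) <;>
    simp only [h2, h3, Bool.or_false, Bool.or_true, if_true, if_false, Bool.false_eq_true] at hk ha ⊢ <;> omega

/-- **Cluster count when every rim pair is open**: `k(conf n) = 1` if some spoke is open (the whole graph is one cluster), `= 2` otherwise (hub + rim cycle).
(transcription of bschramm/prim-bschramm-fk-3/WHEELS-HUB-NC.md §2) -/
theorem clusterCount_conf_of_no_cut (hn2 : 2 ≤ n) (hall : ∀ j, j < n → τ j = true) :
    clusterCount (↑(conf σ τ x v n n) : BondConfig V) (∅ : Set V) = (if (∃ j, j < n ∧ σ j = true) then 0 else 1) + 1 := by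
  have hm : n - 1 + 1 = n := by omega
  obtain ⟨ha, hb, -, hd⟩ := conf_inv hn hinj hx hcard (n - 1) (by omega)
  obtain ⟨hk, -⟩ := confS_facts (σ := σ) (τ := τ) hx (n - 1) (by omega) hb
  obtain ⟨hc0, hs_iff⟩ := run_of_all_open σ τ (n - 1) fun j hj => hall j (by omega)
  have htm : τ (n - 1) = true := hall (n - 1) (by omega)
  have hmod : (n - 1 + 1) % n = 0 := by rw [hm]; exact Nat.mod_self n
  have e1 : conf σ τ x v n n = insert s(v (n - 1), v 0) (confS σ τ x v n (n - 1)) := by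
    rw [← hmod, ← conf_succ_of_open σ τ x v n htm, hm]
  -- `v (n-1)` and `v 0` are already joined along the rim: the closing pair does not change the count
  have hreach : (openGraph (↑(confS σ τ x v n (n - 1)) : BondConfig V)).Reachable (v (n - 1)) (v 0) := by
    have h0 := hd fun j hj => hall j (by omega)
    cases hs : σ (n - 1)
    · rw [confS_of_closed σ τ x v n hs]; exact h0.symm
    · rw [confS_of_open σ τ x v n hs]; exact (reachable_insert_of_reachable _ _ h0).symm
  rw [e1, clusterCount_insert_of_reachable _ hreach]
  -- the indicator `∃ j < n, σ j` versus the automaton data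
  have hiff : ((run σ τ (n - 1)).2 || σ (n - 1)) = true ↔ ∃ j, j < n ∧ σ j = true := by
    rw [Bool.or_eq_true, hs_iff]
    constructor
    · rintro (⟨j, hj, hs⟩ | hs)
      · exact ⟨j, by omega, hs⟩
      · exact ⟨n - 1, by omega, hs⟩
    · rintro ⟨j, hj, hs⟩
      by_cases hjn : j < n - 1
      · exact Or.inl ⟨j, hjn, hs⟩
      · have : j = n - 1 := by omega
        subst this
        exact Or.inr hs
  rw [hc0] at ha
  by_cases hex : ∃ j, j < n ∧ σ j = true
  · rw [if_pos hex]
    have h1 : ((run σ τ (n - 1)).2 || σ (n - 1)) = true := hiff.2 hex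
    rw [h1] at hk
    cases h2 : (run σ τ (n - 1)).2 <;> simp only [h2, if_true, if_false, Bool.false_eq_true] at hk ha ⊢ <;> omega
  · rw [if_neg hex]
    have h1 : ((run σ τ (n - 1)).2 || σ (n - 1)) = false := by
      cases h : ((run σ τ (n - 1)).2 || σ (n - 1))
      · rfl
      · exact absurd (hiff.1 h) hex
    rw [h1] at hk
    cases h2 : (run σ τ (n - 1)).2 <;> simp only [h2, if_true, if_false, Bool.false_eq_true] at hk ha ⊢ <;> omega

end Inv

end Wheel

end FK

end Summit.CriticalPhenomena.PercolationContinuityZ3.Theorems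

end
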